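import Mathlib
import Summits.Ventures.PercRepro2.Defs
import Summits.Ventures.PercRepro2.Independence
import Summits.Ventures.PercRepro2.Harris
import Summits.Ventures.PercRepro2.Graph
import Summits.Ventures.PercRepro2.Exploration
import Summits.Ventures.PercRepro2.RedFavour

/-!
# RED-FAVOUR on an explored cluster: the per-cluster NON-FULL domination
(blind cell PercRepro2, p2 g12; paper proofs/P2-G12-NONFULL.md §3)

Three layers on top of `RedFavour.lean`:

* **Abstract RED-FAVOUR** (`prob_inter_le_prob_preimage_flip_inter`): for a decreasing event `A`
  and an increasing event `I` under weights with `1 - wt e ≤ wt e`, `P(A ∩ I) ≤ P(flip⁻¹ A ∩ I)`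
  — the landed theorem with the two connection events replaced by arbitrary monotone events.
* **The cylinder version** (`prob_inter_le_prob_flipOff_inter_of_dependsOn`): freeze the edges of
  a set `F` (any weights there), reflect only the edges OUTSIDE `F` (`flipOff F`), and allow an
  extra event `K` determined by the edges of `F`: `P(K ∩ A ∩ I) ≤ P(K ∩ (flipOff F)⁻¹ A ∩ I)`.
  Proof: split every configuration into its `F`-part and its outside part (`glue`); for each
  `F`-part the event `K` is constant and the outside events are monotone, so the abstract theorem
  applies on the outside edges; sum back.
* **The explored blue cluster** (`prob_blueCluster_blue_red_le_prob_blueCluster_red_blue`): with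
  `K` = «the blue cluster of `x` is exactly `S`» (`S ∌ p`), `F` = the edges touching `S`:
  P(blue cluster of `x` = `S`, `p ~_b q`, `p ≁_r q`, `W` red-joined)
    ≤ P(blue cluster of `x` = `S`, `p ~_r q`, `p ≁_b q`, `W` red-joined).
  The connectivity input is one closure-lemma argument: a blue path from `p ∉ S` never touches
  `S` (it would put `p` into the blue cluster of `x`), so reflecting the outside turns it into a
  red path, and conversely.
  With `x, y ∈ S` and `W ⊇ {x, y}` (red-joinedness of `x` and `y`), summing over `S` gives the
  NON-FULL `|S| = 2` domination of the m9 lane (paper §3).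
-/

namespace Summit.Ventures.PercRepro2

namespace RedFavour

section Abstract

variable {E : Type*} [Fintype E] [DecidableEq E] {R : Type*} [CommRing R] [PartialOrder R]
  [IsStrictOrderedRing R]

/-- **Abstract RED-FAVOUR.** For a decreasing event `A` and an increasing event `I`, under weights
with `1 - wt e ≤ wt e`: `P(A ∩ I) ≤ P(flip⁻¹ A ∩ I)`. -/
theorem prob_inter_le_prob_preimage_flip_inter {wt : E → R} (hwt : IsProbVec wt)
    (hhalf : ∀ e, 1 - wt e ≤ wt e) {A I : Set (Config E)} (hA : IsLowerSet A)
    (hI : IsUpperSet I) : prob wt (A ∩ I) ≤ prob wt (flip ⁻¹' A ∩ I) := by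
  have hbar : IsProbVec (pbar wt) := isProbVec_pbar hwt
  have hle : pbar wt ≤ wt := fun e => hhalf e
  have h1 : prob wt (A ∩ I) ≤ prob wt A * prob wt I :=
    prob_inter_le_prob_mul_prob_of_isLowerSet hwt hA hI
  have h2 : prob wt A ≤ prob (pbar wt) A := prob_le_prob_of_le_of_isLowerSet hbar hwt hle hA
  have h3 : prob wt I = prob (pbar wt) (flip ⁻¹' I) := by
    rw [prob_preimage_flip, pbar_pbar]
  have h4 : prob (pbar wt) A * prob (pbar wt) (flip ⁻¹' I) ≤ prob (pbar wt) (A ∩ flip ⁻¹' I) :=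
    prob_mul_prob_le_prob_inter_of_isLowerSet hbar hA (isLowerSet_preimage_flip hI)
  have h5 : prob (pbar wt) (A ∩ flip ⁻¹' I) = prob wt (flip ⁻¹' A ∩ I) := by
    rw [← prob_preimage_flip, Set.preimage_inter, preimage_flip_flip]
  have hI0 : 0 ≤ prob wt I := prob_nonneg hwt I
  calc prob wt (A ∩ I) ≤ prob wt A * prob wt I := h1
    _ ≤ prob (pbar wt) A * prob wt I := mul_le_mul_of_nonneg_right h2 hI0
    _ = prob (pbar wt) A * prob (pbar wt) (flip ⁻¹' I) := by rw [h3]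
    _ ≤ prob (pbar wt) (A ∩ flip ⁻¹' I) := h4
    _ = prob wt (flip ⁻¹' A ∩ I) := h5

end Abstract

section FlipOff

variable {E : Type*}

/-- Reflect the colours of the edges OUTSIDE `F` only. -/
def flipOff (F : Set E) [DecidablePred (· ∈ F)] (ω : Config E) : Config E :=
  fun e => if e ∈ F then ω e else !ω e

/-- `flipOff` on an edge of `F`. -/
lemma flipOff_apply_of_mem (F : Set E) [DecidablePred (· ∈ F)] (ω : Config E) {e : E}
    (h : e ∈ F) : flipOff F ω e = ω e := if_pos h

/-- `flipOff` on an edge outside `F`. -/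
lemma flipOff_apply_of_notMem (F : Set E) [DecidablePred (· ∈ F)] (ω : Config E) {e : E}
    (h : e ∉ F) : flipOff F ω e = !ω e := if_neg h

/-- `flipOff F` acts on a glued configuration by reflecting the outside part. -/
lemma flipOff_glue (F : Set E) [DecidablePred (· ∈ F)] (σ₁ : {e // e ∈ F} → Bool)
    (σ₂ : {e // e ∉ F} → Bool) : flipOff F (glue F σ₁ σ₂) = glue F σ₁ (flip σ₂) := by
  funext e
  by_cases h : e ∈ F
  · rw [flipOff_apply_of_mem F _ h, glue_apply_of_mem F _ _ h, glue_apply_of_mem F _ _ h]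
  · rw [flipOff_apply_of_notMem F _ h, glue_apply_of_notMem F _ _ h, glue_apply_of_notMem F _ _ h]
    rfl

/-- `glue F σ₁` is monotone in the outside part. -/
lemma glue_mono (F : Set E) [DecidablePred (· ∈ F)] (σ₁ : {e // e ∈ F} → Bool)
    {σ₂ σ₂' : {e // e ∉ F} → Bool} (h : σ₂ ≤ σ₂') : glue F σ₁ σ₂ ≤ glue F σ₁ σ₂' := by
  intro e
  by_cases he : e ∈ F
  · rw [glue_apply_of_mem F _ _ he, glue_apply_of_mem F _ _ he]
  · rw [glue_apply_of_notMem F _ _ he, glue_apply_of_notMem F _ _ he]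
    exact h ⟨e, he⟩

/-- Two glued configurations with the same `F`-part agree on `F`. -/
lemma glue_eqOn (F : Set E) [DecidablePred (· ∈ F)] (σ₁ : {e // e ∈ F} → Bool)
    (σ₂ σ₂' : {e // e ∉ F} → Bool) : ∀ e ∈ F, glue F σ₁ σ₂ e = glue F σ₁ σ₂' e := by
  intro e he
  rw [glue_apply_of_mem F _ _ he, glue_apply_of_mem F _ _ he]

end FlipOff

section Cylinder

variable {E : Type*} [Fintype E] [DecidableEq E] {R : Type*} [CommRing R]

/-- A probability as a sum over the `F`-parts of the weighted probabilities of the outside parts. -/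
lemma prob_eq_sum_glue (p : E → R) (S : Set (Config E)) (F : Set E) [DecidablePred (· ∈ F)] :
    prob p S = ∑ σ₁ : {e // e ∈ F} → Bool, weight (fun i : {e // e ∈ F} => p i) σ₁ *
      prob (fun i : {e // e ∉ F} => p i) {σ₂ | glue F σ₁ σ₂ ∈ S} := by
  rw [prob_eq_expect_indicator, expect_eq_sum_glue p _ F]
  refine Finset.sum_congr rfl fun σ₁ _ => ?_
  rw [prob_eq_expect_indicator, expect, Finset.mul_sum]
  refine Finset.sum_congr rfl fun σ₂ _ => ?_
  rw [mul_assoc]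
  congr 1

variable [PartialOrder R] [IsStrictOrderedRing R]

/-- **RED-FAVOUR, cylinder version.** Freeze the edges of `F` (any admissible weights there) and
reflect only the outside; an event `K` determined by the edges of `F` may be added: for a
decreasing `A` and an increasing `I`, `P(K ∩ A ∩ I) ≤ P(K ∩ (flipOff F)⁻¹ A ∩ I)` as soon as
`1 - wt e ≤ wt e` on the edges outside `F`. -/
theorem prob_inter_le_prob_flipOff_inter_of_dependsOn {wt : E → R} (hwt : IsProbVec wt)
    (F : Set E) [DecidablePred (· ∈ F)] (hhalf : ∀ e, e ∉ F → 1 - wt e ≤ wt e)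
    {K A I : Set (Config E)} (hK : DependsOn (· ∈ K) F) (hA : IsLowerSet A) (hI : IsUpperSet I) :
    prob wt (K ∩ A ∩ I) ≤ prob wt (K ∩ flipOff F ⁻¹' A ∩ I) := by
  rw [prob_eq_sum_glue wt _ F, prob_eq_sum_glue wt _ F]
  refine Finset.sum_le_sum fun σ₁ _ => ?_
  have hw1 : IsProbVec (fun i : {e // e ∈ F} => wt i) := ⟨fun i => hwt.nonneg i, fun i => hwt.le_one i⟩
  have hw2 : IsProbVec (fun i : {e // e ∉ F} => wt i) := ⟨fun i => hwt.nonneg i, fun i => hwt.le_one i⟩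
  refine mul_le_mul_of_nonneg_left ?_ (weight_nonneg hw1 σ₁)
  have hKconst : ∀ σ₂ σ₂' : {e // e ∉ F} → Bool,
      (glue F σ₁ σ₂ ∈ K) = (glue F σ₁ σ₂' ∈ K) := fun σ₂ σ₂' => hK (glue_eqOn F σ₁ σ₂ σ₂')
  by_cases hk : glue F σ₁ (fun _ => false) ∈ K
  · have hK' : ∀ σ₂, glue F σ₁ σ₂ ∈ K := fun σ₂ => by rw [hKconst σ₂ (fun _ => false)]; exact hk
    have e1 : {σ₂ : {e // e ∉ F} → Bool | glue F σ₁ σ₂ ∈ K ∩ A ∩ I} =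
        {σ₂ | glue F σ₁ σ₂ ∈ A} ∩ {σ₂ | glue F σ₁ σ₂ ∈ I} := by
      ext σ₂; simp [hK' σ₂]
    have e2 : {σ₂ : {e // e ∉ F} → Bool | glue F σ₁ σ₂ ∈ K ∩ flipOff F ⁻¹' A ∩ I} =
        flip ⁻¹' {σ₂ | glue F σ₁ σ₂ ∈ A} ∩ {σ₂ | glue F σ₁ σ₂ ∈ I} := by
      ext σ₂; simp [hK' σ₂, flipOff_glue]
    rw [e1, e2]
    refine prob_inter_le_prob_preimage_flip_inter hw2 (fun i => hhalf i i.2) ?_ ?_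
    · intro σ₂ σ₂' hle hσ
      exact hA (glue_mono F σ₁ hle) hσ
    · intro σ₂ σ₂' hle hσ
      exact hI (glue_mono F σ₁ hle) hσ
  · have hK' : ∀ σ₂, glue F σ₁ σ₂ ∉ K := fun σ₂ => by rw [hKconst σ₂ (fun _ => false)]; exact hk
    have e1 : {σ₂ : {e // e ∉ F} → Bool | glue F σ₁ σ₂ ∈ K ∩ A ∩ I} = ∅ := by
      ext σ₂; simp [hK' σ₂]
    have e2 : {σ₂ : {e // e ∉ F} → Bool | glue F σ₁ σ₂ ∈ K ∩ flipOff F ⁻¹' A ∩ I} = ∅ := by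
      ext σ₂; simp [hK' σ₂]
    rw [e1, e2]

end Cylinder

section Cluster

variable {V : Type*} {E : Type*}

/-- A path from `p` outside the cluster `S` of `x` never uses an edge touching `S`: if `p ∉ S`
and `p ↔ q` in `ω`, then `p ↔ q` already in `ω` with every edge touching `S` closed (`restrict G ω`
for any `G` containing the edges not touching `S`). -/
lemma conn_restrict_of_cluster_eq {ends : E → Sym2 V} {ω : Config E} {x p q : V} {S : Set V}
    (hS : cluster ends ω x = S) (hp : p ∉ S) (G : Set E) [DecidablePred (· ∈ G)]
    (hG : ∀ e, e ∉ touches ends S → e ∈ G) (h : Conn ends ω p q) :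
    Conn ends (restrict G ω) p q := by
  have hnot : ∀ z, z ∈ S → Conn ends ω p z → False := by
    intro z hz hpz
    rw [← hS] at hz hp
    exact hp (conn_trans hz (conn_symm hpz))
  refine mem_of_conn_of_closed (S := {u | Conn ends (restrict G ω) p u}) ?_ (conn_refl _ _ _) h
  intro u hu w huw
  obtain ⟨_, e, he, hends⟩ := openGraph_adj.1 huw
  have hpu : Conn ends ω p u := conn_mono (restrict_le G ω) hu
  have hpw : Conn ends ω p w := conn_trans hpu (conn_of_openAdj ⟨e, he, hends⟩)
  have heG : e ∈ G := by
    refine hG e fun hmem => ?_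
    obtain ⟨z, hz, z', hzz'⟩ := hmem
    rw [hends, Sym2.eq_iff] at hzz'
    rcases hzz' with ⟨rfl, _⟩ | ⟨_, rfl⟩
    · exact hnot _ hz hpu
    · exact hnot _ hz hpw
  have he' : restrict G ω e = true := restrict_eq_true_iff.2 ⟨he, heG⟩
  exact conn_trans hu (conn_of_openAdj ⟨e, he', hends⟩)

/-- The event «the BLUE cluster of `x` is exactly `S`». -/
def blueClusterEvent (ends : E → Sym2 V) (x : V) (S : Set V) : Set (Config E) :=
  {ω | cluster ends (flip ω) x = S}

/-- The blue-cluster event is determined by the edges touching `S`. -/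
lemma dependsOn_blueClusterEvent (ends : E → Sym2 V) (x : V) (S : Set V) :
    DependsOn (· ∈ blueClusterEvent ends x S) (touches ends S) := by
  intro ω ω' h
  have h' : ∀ e ∈ touches ends S, flip ω e = flip ω' e := fun e he => by
    simp only [flip_apply, h e he]
  exact propext ⟨cluster_eq_of_eqOn_touches h', cluster_eq_of_eqOn_touches fun e he => (h' e he).symm⟩

/-- On the blue-cluster event with `p ∉ S`: a blue `p`–`q` path reflected outside `S` is a red
`p`–`q` path (the blue path never touches `S`). -/
lemma redConn_of_blueConn_flipOff {ends : E → Sym2 V} {x p q : V} {S : Set V}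
    [DecidablePred (· ∈ touches ends S)] {ω : Config E}
    (hK : ω ∈ blueClusterEvent ends x S) (hp : p ∉ S)
    (h : Conn ends (flip ω) p q) : Conn ends (flipOff (touches ends S) ω) p q := by
  have h1 : Conn ends (restrict (touches ends S)ᶜ (flip ω)) p q :=
    conn_restrict_of_cluster_eq hK hp (touches ends S)ᶜ (fun e he => he) h
  refine conn_mono ?_ h1
  intro e
  by_cases he : e ∈ touches ends S
  · rw [restrict_apply_of_notMem (show e ∉ (touches ends S)ᶜ from fun h' => h' he)]
    exact Bool.false_le _
  · rw [restrict_apply_of_mem (show e ∈ (touches ends S)ᶜ from he),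
      flipOff_apply_of_notMem _ _ he]
    exact le_rfl

/-- On the blue-cluster event with `p ∉ S`: a blue `p`–`q` path of the outside-reflected
configuration is a red `p`–`q` path of the original one. -/
lemma redConn_of_flipOff_blueConn {ends : E → Sym2 V} {x p q : V} {S : Set V}
    [DecidablePred (· ∈ touches ends S)] {ω : Config E}
    (hK : ω ∈ blueClusterEvent ends x S) (hp : p ∉ S)
    (h : Conn ends (flip (flipOff (touches ends S) ω)) p q) : Conn ends ω p q := by
  have hK' : cluster ends (flip (flipOff (touches ends S) ω)) x = S := by
    refine cluster_eq_of_eqOn_touches (ω := flip ω) ?_ hK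
    intro e he
    simp only [flip_apply, flipOff_apply_of_mem _ _ he]
  have h1 : Conn ends (restrict (touches ends S)ᶜ (flip (flipOff (touches ends S) ω))) p q :=
    conn_restrict_of_cluster_eq hK' hp (touches ends S)ᶜ (fun e he => he) h
  refine conn_mono ?_ h1
  intro e
  by_cases he : e ∈ touches ends S
  · rw [restrict_apply_of_notMem (show e ∉ (touches ends S)ᶜ from fun h' => h' he)]
    exact Bool.false_le _
  · rw [restrict_apply_of_mem (show e ∈ (touches ends S)ᶜ from he)]
    simp only [flip_apply, flipOff_apply_of_notMem _ _ he, Bool.not_not]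
    exact le_rfl

variable [Fintype E] [DecidableEq E] {R : Type*} [CommRing R] [PartialOrder R]
  [IsStrictOrderedRing R]

/-- **RED-FAVOUR on an explored blue cluster.** For `S ∌ p` and any vertex set `W`:
P(blue cluster of `x` = `S`, `p ~_b q`, `p ≁_r q`, `W` red-joined)
  ≤ P(blue cluster of `x` = `S`, `p ~_r q`, `p ≁_b q`, `W` red-joined),
under any admissible weights with `1 - wt e ≤ wt e`. -/
theorem prob_blueCluster_blue_red_le_prob_blueCluster_red_blue (ends : E → Sym2 V)
    (p q x : V) (S : Set V) (W : Set V) {wt : E → R} (hwt : IsProbVec wt)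
    (hhalf : ∀ e, 1 - wt e ≤ wt e) (hp : p ∉ S) :
    prob wt (blueClusterEvent ends x S ∩ (blueConn ends p q ∩ (redConn ends p q)ᶜ) ∩
        redJoined ends p q W) ≤
      prob wt (blueClusterEvent ends x S ∩ (redConn ends p q ∩ (blueConn ends p q)ᶜ) ∩
        redJoined ends p q W) := by
  classical
  have hA : IsLowerSet (blueConn ends p q ∩ (redConn ends p q)ᶜ) :=
    (isLowerSet_blueConn ends p q).inter (isUpperSet_redConn ends p q).compl
  have hI : IsUpperSet (redJoined ends p q W) := isUpperSet_redJoined ends p q W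
  have h1 := prob_inter_le_prob_flipOff_inter_of_dependsOn hwt (touches ends S)
    (fun e _ => hhalf e) (dependsOn_blueClusterEvent ends x S) hA hI
  refine h1.trans (prob_mono hwt ?_)
  rintro ω ⟨⟨hK, hflip⟩, hW⟩
  refine ⟨⟨hK, ?_, ?_⟩, hW⟩
  · -- `p ~_r q` in `ω` from `p ~_b q` in the outside-reflected configuration
    exact redConn_of_flipOff_blueConn hK hp hflip.1
  · -- `p ≁_b q` in `ω`: a blue path would reflect to a red path of the outside-reflected
    -- configuration, contradicting `p ≁_r q` there
    intro hb
    exact hflip.2 (redConn_of_blueConn_flipOff hK hp hb)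

omit [PartialOrder R] [IsStrictOrderedRing R] in
/-- The events «the blue cluster of `x` is `S`» partition the configurations: a probability is
the sum over `S` of the probabilities on these events. -/
lemma prob_eq_sum_blueClusterEvent [Fintype V] [DecidableEq V] (ends : E → Sym2 V) (x : V)
    (wt : E → R) (B : Set (Config E)) :
    prob wt B = ∑ S : Set V, prob wt (blueClusterEvent ends x S ∩ B) := by
  classical
  unfold prob
  rw [Finset.sum_comm]
  refine Finset.sum_congr rfl fun ω _ => ?_
  rw [Finset.sum_eq_single (cluster ends (flip ω) x)]
  · by_cases hB : ω ∈ B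
    · rw [Set.indicator_of_mem hB, Set.indicator_of_mem (show ω ∈ blueClusterEvent ends x
        (cluster ends (flip ω) x) ∩ B from ⟨rfl, hB⟩)]
    · rw [Set.indicator_of_notMem hB, Set.indicator_of_notMem (fun h => hB h.2)]
  · intro S _ hS
    exact Set.indicator_of_notMem (fun h => hS h.1.symm) _
  · intro h
    exact absurd (Finset.mem_univ _) h

/-- `x` and `y` are blue-connected. -/
def pairBlue (ends : E → Sym2 V) (x y : V) : Set (Config E) := {ω | Conn ends (flip ω) x y}

/-- `x` is not blue-joined to `p` nor to `q` (`x ∉ C`). -/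
def notBlueJoined (ends : E → Sym2 V) (p q x : V) : Set (Config E) :=
  {ω | ¬ Conn ends (flip ω) p x ∧ ¬ Conn ends (flip ω) q x}

omit [Fintype E] [DecidableEq E] in
/-- On the blue-cluster event of `x` with `S ∋ y`, `S ∌ p, q`: `x ~_b y` and `x ∉ C`. -/
lemma mem_pairBlue_notBlueJoined_of_blueClusterEvent {ends : E → Sym2 V} {p q x y : V}
    {S : Set V} {ω : Config E} (hK : ω ∈ blueClusterEvent ends x S) (hy : y ∈ S) (hp : p ∉ S)
    (hq : q ∉ S) : ω ∈ pairBlue ends x y ∧ ω ∈ notBlueJoined ends p q x := by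
  have hK' : cluster ends (flip ω) x = S := hK
  refine ⟨?_, ?_, ?_⟩
  · rw [← hK'] at hy; exact hy
  · intro h; exact hp (hK' ▸ (conn_symm h : Conn ends (flip ω) x p))
  · intro h; exact hq (hK' ▸ (conn_symm h : Conn ends (flip ω) x q))

omit [Fintype E] [DecidableEq E] in
/-- Conversely, `x ~_b y` and `x ∉ C` force `y ∈ S`, `p ∉ S`, `q ∉ S` for the blue cluster `S`. -/
lemma blueCluster_props_of_mem {ends : E → Sym2 V} {p q x y : V} {S : Set V} {ω : Config E}
    (hK : ω ∈ blueClusterEvent ends x S) (h1 : ω ∈ pairBlue ends x y)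
    (h2 : ω ∈ notBlueJoined ends p q x) : y ∈ S ∧ p ∉ S ∧ q ∉ S := by
  have hK' : cluster ends (flip ω) x = S := hK
  refine ⟨?_, ?_, ?_⟩
  · rw [← hK']; exact h1
  · intro hp; rw [← hK'] at hp; exact h2.1 (conn_symm hp)
  · intro hq; rw [← hK'] at hq; exact h2.2 (conn_symm hq)

/-- **The NON-FULL pair domination (NF2).** For marks `p, q` and vertices `x, y`, under any
admissible weights with `1 - wt e ≤ wt e`:
P(`x ~_b y`, `x ∉ C`, `p ~_b q`, `p ≁_r q`, `x, y` red-joined)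
  ≤ P(`x ~_b y`, `x ∉ C`, `p ~_r q`, `p ≁_b q`, `x, y` red-joined).
(On the left `x, y` are red-only and blue-connected while `p, q` are blue-connected and
red-disconnected; the right-hand side is the same with the roles of the colours at `p, q`
exchanged. Under the uniform weights the right-hand side is, by the colour reflection, the number
of configurations with `x, y` blue-only and red-connected, `p ~_b q`, `p ≁_r q` — the |S| = 2
domination without the fullness clause.) -/
theorem prob_pair_blue_red_le_prob_pair_red_blue [Fintype V] [DecidableEq V]
    (ends : E → Sym2 V) (p q x y : V) {wt : E → R} (hwt : IsProbVec wt)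
    (hhalf : ∀ e, 1 - wt e ≤ wt e) :
    prob wt (pairBlue ends x y ∩ notBlueJoined ends p q x ∩
        (blueConn ends p q ∩ (redConn ends p q)ᶜ) ∩ redJoined ends p q {x, y}) ≤
      prob wt (pairBlue ends x y ∩ notBlueJoined ends p q x ∩
        (redConn ends p q ∩ (blueConn ends p q)ᶜ) ∩ redJoined ends p q {x, y}) := by
  classical
  rw [prob_eq_sum_blueClusterEvent ends x, prob_eq_sum_blueClusterEvent ends x]
  refine Finset.sum_le_sum fun S _ => ?_
  by_cases hS : y ∈ S ∧ p ∉ S ∧ q ∉ S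
  · obtain ⟨hy, hp, hq⟩ := hS
    have eL : blueClusterEvent ends x S ∩ (pairBlue ends x y ∩ notBlueJoined ends p q x ∩
        (blueConn ends p q ∩ (redConn ends p q)ᶜ) ∩ redJoined ends p q {x, y}) =
        blueClusterEvent ends x S ∩ (blueConn ends p q ∩ (redConn ends p q)ᶜ) ∩
          redJoined ends p q {x, y} := by
      ext ω
      constructor
      · rintro ⟨hK, ⟨⟨_, _⟩, hA⟩, hI⟩; exact ⟨⟨hK, hA⟩, hI⟩
      · rintro ⟨⟨hK, hA⟩, hI⟩
        obtain ⟨h1, h2⟩ := mem_pairBlue_notBlueJoined_of_blueClusterEvent hK hy hp hq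
        exact ⟨hK, ⟨⟨h1, h2⟩, hA⟩, hI⟩
    have eR : blueClusterEvent ends x S ∩ (pairBlue ends x y ∩ notBlueJoined ends p q x ∩
        (redConn ends p q ∩ (blueConn ends p q)ᶜ) ∩ redJoined ends p q {x, y}) =
        blueClusterEvent ends x S ∩ (redConn ends p q ∩ (blueConn ends p q)ᶜ) ∩
          redJoined ends p q {x, y} := by
      ext ω
      constructor
      · rintro ⟨hK, ⟨⟨_, _⟩, hA⟩, hI⟩; exact ⟨⟨hK, hA⟩, hI⟩
      · rintro ⟨⟨hK, hA⟩, hI⟩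
        obtain ⟨h1, h2⟩ := mem_pairBlue_notBlueJoined_of_blueClusterEvent hK hy hp hq
        exact ⟨hK, ⟨⟨h1, h2⟩, hA⟩, hI⟩
    rw [eL, eR]
    exact prob_blueCluster_blue_red_le_prob_blueCluster_red_blue ends p q x S {x, y} hwt hhalf hp
  · have eL : blueClusterEvent ends x S ∩ (pairBlue ends x y ∩ notBlueJoined ends p q x ∩
        (blueConn ends p q ∩ (redConn ends p q)ᶜ) ∩ redJoined ends p q {x, y}) = ∅ := by
      ext ω
      refine ⟨?_, fun h => h.elim⟩
      rintro ⟨hK, ⟨⟨h1, h2⟩, _⟩, _⟩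
      exact (hS (blueCluster_props_of_mem hK h1 h2)).elim
    rw [eL]
    have h0 : prob wt (∅ : Set (Config E)) = 0 := by simp [prob]
    rw [h0]
    exact prob_nonneg hwt _

end Cluster

end RedFavour

end Summit.Ventures.PercRepro2
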